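import Literature.NumberTheory.PAdicHodge.FontaineDpst
import Literature.NumberTheory.GaloisRepresentations.FramedRepTwist
import HarnessLib

/-!
# Labelled Hodge–Tate weights of THE pinned Fontaine data under finite restriction and under twist
# by a de Rham character (two named schemata)

Topic `NumberTheory/PAdicHodge`.  Two NAMED FACTS (D-0014) about Fontaine's `D_dR` for THE pinned data
`fontainePst` (file `FontaineDpst`), in the shape of the local HYPOTHESES `hHT`, `hcr` that the accepted
`GaloisRepresentations/ToLocalRestrictField` and the accepted named fact `DeRhamBaseChange` carry for the
same data: statements relating the data of two (finite, possibly degree-one) `ℓ`-adic local fields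
`K → L`, which are theorems for Fontaine's construction (functoriality / Galois descent of `D_dR`) and
are not derivable for the ε-pinned terms at two distinct types (module docstring of `FontaineDpst`,
"What REMAINS pinned"; they become theorems-by-construction at step D2 of its Upgrade path).
Wanted by crux `stmt-Langlands-17000` (`NonParallelVoid.TwistedInductionParallel`, line
`symmetrise-pd-split`): stub 4 (wave-1 proof) and stub 3 (labelled weights of the induced twist).

* `LabelledWeightsRestrictSchema` — **label by label**, `HT_{τ''}(ρ|_{Γ_L}) = HT_{τ'}(ρ)` for a
  `ℚ_ℓ`-embedding `τ''` of `L` extending `τ'` of `K`: Fontaine, `D_{dR,L}(V) = L ⊗_K D_{dR,K}(V)` as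
  filtered modules (Exp. III §1.5, §3; Brinon–Conrad Prop. 6.3.8), whose `τ''`-component is the
  `τ'`-component; Patrikis §2.7.1 ("`HT_{τ}(V|_{Γ_L}) = HT_{τ|_K}(V)`").  The label-wise sharpening of
  the hypothesis `hHT` of `labelledHodgeTateWeightsAt_restrictField_eq_of_liesOver`, which transports
  only "all labels have weights `S`".  True for ALL `ρ` (no de Rham hypothesis: `D_dR` descends).
* `LabelledWeightsTwistSchema` — twisting by a continuous character `χ` whose rank-one avatar `χ · 1`
  is de Rham of labelled weight `{k}` shifts the labelled weights of any `ρ` by `k`: `D_dR` is a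
  `⊗`-functor on de Rham objects with the product filtration (apply it to `χ` and `χ⁻¹`; Fontaine
  Exp. III §1.5; Brinon–Conrad §6.3).  The tree PROVES the special case `χ = ε^m`
  (`LabelledWeightsTateTwist.labelledHodgeTateWeightsAt_twist_of_cyclotomic_zpow`).

## References

* [FontaineAsterisque223III] J.-M. Fontaine, *Représentations p-adiques semi-stables*, Astérisque 223
  (1994), Exp. III §1.5, §3.
* [BrinonConrad2009] O. Brinon, B. Conrad, *CMI Summer School notes on p-adic Hodge theory* (2009),
  Prop. 6.3.8, §6.3.
* [Patrikis2019] S. Patrikis, *Variations on a theorem of Tate*, Mem. AMS 258 (2019), §2.7.1.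
-/

noncomputable section

open Field ValuativeRel
open Literature.NumberTheory.GaloisRepresentations

namespace Literature.NumberTheory.PAdicHodge

/-- **Labelled Hodge–Tate weights are insensitive to finite restriction, LABEL BY LABEL, for THE
pinned Fontaine data** (`fontainePst`): for a continuous embedding `K → L` of `ℓ`-adic local fields,
`ρ : Γ_K → GL_n(ℚ̄_ℓ)` and a `ℚ_ℓ`-embedding `τ'' : L → ℚ̄_ℓ` extending `τ' : K → ℚ̄_ℓ`,
`HT_{τ''}(ρ|_{Γ_L}) = HT_{τ'}(ρ)`.  Fontaine: `D_{dR,L}(V) = L ⊗_K D_{dR,K}(V)` as filtered modules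
(Galois descent), whose `τ''`-component is the `τ'`-component of `D_{dR,K}(V)`; Patrikis §2.7.1
(`HT_{τ''}(V|_{Γ_L}) = HT_{τ''|_K}(V)`), Brinon–Conrad Prop. 6.3.8.  The label-wise sharpening of the
hypothesis `hHT` of the tree's `labelledHodgeTateWeightsAt_restrictField_eq_of_liesOver`
(`ToLocalRestrictField`), which only transports "all labels have weights `S`".
[cite: FontaineAsterisque223III, Exp. III §1.5 and §3] [cite: BrinonConrad2009, Prop. 6.3.8]
[cite: Patrikis2019, §2.7.1] -/
def LabelledWeightsRestrictSchema : Prop :=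
  ∀ (ℓ : ℕ) [Fact ℓ.Prime] (K L : Type) [Field K] [ValuativeRel K] [TopologicalSpace K]
    [IsNonarchimedeanLocalField K] [CharZero K] [Field L] [ValuativeRel L] [TopologicalSpace L]
    [IsNonarchimedeanLocalField L] [CharZero L] [Algebra K L], Continuous (algebraMap K L) →
    ∀ (hK : valuation K (ℓ : K) < 1) (hL : valuation L (ℓ : L) < 1) (n : ℕ)
      (ρ : FramedRep (absoluteGaloisGroup K) (PadicAlgCl ℓ) n),
      letI := (fontainePst K ℓ hK).algebra
      letI := (fontainePst L ℓ hL).algebra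
      ∀ (τ' : K →ₐ[ℚ_[ℓ]] PadicAlgCl ℓ) (τ'' : L →ₐ[ℚ_[ℓ]] PadicAlgCl ℓ),
        τ''.toRingHom.comp (algebraMap K L) = τ'.toRingHom →
        (fontainePst L ℓ hL).𝔅.labelledHodgeTateWeights
            (FramedRep.toContinuousRep (ρ.comp (absGaloisRestrict K L))) τ''.toRingHom =
          (fontainePst K ℓ hK).𝔅.labelledHodgeTateWeights (FramedRep.toContinuousRep ρ) τ'.toRingHom

/-- **Twisting by a de Rham character of labelled weight `k` shifts the labelled weights by `k`, for
THE pinned Fontaine datum**: for `ρ : Γ_K → GL_n(ℚ̄_ℓ)`, a continuous `χ : Γ_K → ℚ̄_ℓˣ` with `χ · 1`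
de Rham and `HT_τ(χ · 1) = {k}`, `HT_τ(ρ ⊗ χ) = {h + k : h ∈ HT_τ(ρ)}`.  Fontaine: `D_dR` is a
`⊗`-functor on de Rham objects, `D_dR(V ⊗ χ) = D_dR(V) ⊗ D_dR(χ)` with the product filtration (apply it
to `χ` and `χ⁻¹`; no de Rham hypothesis on `V` is needed), read on `τ`-components.  The tree proves
the special case `χ = ε^m` (`LabelledWeightsTateTwist.labelledHodgeTateWeightsAt_twist_of_cyclotomic_zpow`).
[cite: FontaineAsterisque223III, Exp. III §1.5] [cite: BrinonConrad2009, §6.3] [cite: Patrikis2019, §2.7.1] -/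
def LabelledWeightsTwistSchema : Prop :=
  ∀ (ℓ : ℕ) [Fact ℓ.Prime] (K : Type) [Field K] [ValuativeRel K] [TopologicalSpace K]
    [IsNonarchimedeanLocalField K] [CharZero K] (hK : valuation K (ℓ : K) < 1) (n : ℕ)
    (ρ : FramedRep (absoluteGaloisGroup K) (PadicAlgCl ℓ) n)
    (χ : absoluteGaloisGroup K →ₜ* (PadicAlgCl ℓ)ˣ) (k : ℤ),
    (fontainePst K ℓ hK).IsDeRhamFramed ((FramedRep.scalar (PadicAlgCl ℓ) 1).comp χ) →
    letI := (fontainePst K ℓ hK).algebra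
    ∀ τ : K →ₐ[ℚ_[ℓ]] PadicAlgCl ℓ,
      (fontainePst K ℓ hK).𝔅.labelledHodgeTateWeights
          (FramedRep.toContinuousRep ((FramedRep.scalar (PadicAlgCl ℓ) 1).comp χ)) τ.toRingHom = {k} →
      (fontainePst K ℓ hK).𝔅.labelledHodgeTateWeights
          (FramedRep.toContinuousRep (ρ.twist χ)) τ.toRingHom =
        ((fontainePst K ℓ hK).𝔅.labelledHodgeTateWeights (FramedRep.toContinuousRep ρ) τ.toRingHom).map
          fun h => h + k


end Literature.NumberTheory.PAdicHodge

end
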